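import Summits.QuantumFields.BalabanUV.T4Continuum.Support.NE4ReadOutSocket
import Summits.QuantumFields.BalabanUV.T4Continuum.Support.NE4GaussianCouplingTwoPoint

/-!
# NE4ReadOutSocketGaussian — binder row NE4 (spine node U2) with row NE9's COUPLING TWO-POINT clause PRODUCED from Gaussian
# letters: node U2's NE4 triple and its spine-currency output `InjectedRate` on t-HISTORIES, from row NE9's END
# `NE9LastCouplingBridge` (the coupling channel fed by `NE4GaussianCouplingTwoPoint` ∘ `NE9FormGaussian`), row NE5's END
# `OutputRateResidual` and the node-U2 read-out (R), BY NAME, every conditional a displayed binder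
# (cell `pub-balaban`, T⁴-continuum fan-out, `HOME/BINDER-OWNERS.md` row NE4, owner lineage t4-ne4-p1, generation 33)

HONEST FRAMING (T4-DAG PAGE 1).  The cell's T⁴ target is rung (B)+1: existence AND uniqueness of the ε → 0 limit of
gauge-invariant observables on a FIXED finite torus T⁴ — NOT infinite volume, NOT a mass gap, NOT the Clay problem.  The
spine estimate NE4 (η-rate of the full β_k, shape `T4CouplingMatching.ScaleShiftRate`) is NOT PRINTED in
[Balaban1987RG1]–[Balaban1989LargeFieldII] and is NOT PROVED here: node U2 is DEPENDENT — its inputs are an INSTANCE of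
NE5 ∧ NE9 ∧ FadingMemory (node U3) composed with the printed-STRUCTURE read-out of [Balaban1987RG1] (1.20)–(1.22) p. 264 —
and NE5, NE9 are the cell's own estimates, NOT PRINTED, NOT PROVED (spine estimates proved: 0/9, unchanged by this module).
Nothing printed is asserted; no quotation is introduced (0 cite tags here; the located print of every binder is in the
imported leaves' docstrings).  `FlowStep.BetaPertH`, (B), (B^μ) do not occur and are NOT hidden: they live in the windows
`W`/`Wt` and the runs of whoever instantiates.  HONEST DEPENDENCY (cell, verbatim): continuum YM on T⁴ ⇐ BetaPertH ∧ nine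
spine estimates (0/9 proved); BetaPertH ⇐ (D1) ∧ (D4) ∧ CAP+tail; G-an2-4 gates asym, D1 and NE2/3/4.

WHAT THIS MODULE IS.  The fourth face of row NE4's DEPENDENT booking (siblings: `NE4ReadOutSocket` p202738 — W1 entrywise,
W4 posited; `NE4ReadOutSocketInsertion` p204067 — W4 produced; `NE4ReadOutSocketTower` p204070 — W1 := NE2-law ∧ NE3-LocalRate):
here row NE9's END `NE9LastCouplingBridge.ne9_and_fadingMemory_of_couplingTwoPoint` (p201771) is fed with its COUPLING
TWO-POINT clause `hCup` PRODUCED — by `NE4GaussianCouplingTwoPoint.couplingTwoPoint_of_gaussian` from row NE9's Gaussian-letters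
END `NE9FormGaussian.norm_formAct_sub_formAct_le_gaussian` (p204271) — so that the coupling channel of node U2's NE9 input is
displayed as three printed-TYPE statements per index (analyticity at `(1+c)ε₁`, box bounds, (2.15)–(2.22) domination) plus
the residual comparison with the (2.38)-majorant, instead of a two-point clause.  CURRENCY: those letters bound the coupling
modulus in `t = g⁻²` only (coupling-free constant on `]0, γ]`; the g-form does not follow, tree no-go
`T4CouplingAnalyticity.exists_couplingAnalyticRel_not_ne9Window`), so this face is typed on t-HISTORIES: row NE9's END for a
term family `Et` of the t-history over a t-window `Wt` (floor `γ⁻²`, containing the t-images of the padded box histories),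
row NE5's END and the read-out (R) for the re-parametrised family `T4CurrencyMatching.reparam invSq Et` over the coupling
window `W`, and the history moduli of β concluded in the currency `t` (`T4CurrencyMatching.HistLipschitzBy invSq`):

* §0 `histLipschitzBy_of_ne9_on` — `T4CurrencyMatching.histLipschitzBy_of_ne9` with the read-out bound on a CLASS of slices
  (`ReadBoundedOn`, the restricted (R) of `T4BetaReadOutLipschitz`); the case `φ = id` is `histLipschitz_of_ne9_on`.
* §1 `ne4T_of_gaussNE9_endNE5` — THE ROW's TRIPLE on t-histories: `ScaleShiftRate (cr·C₅·θ₅) θ₅ γ β ∧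
  HistLipschitzBy invSq (cr·Λ(·+1)) γ β ∧ T4CouplingMatching.FadingMemory (cr·(ℓ/ν)·ν) ν (cr·Λ(·+1))`, `Λ = prodModuli ℓ (fun _ => ν)`,
  from (GAUSS) the Gaussian family's binders and its two majorant comparisons, the REST of row NE9's END binders verbatim
  (`hCup` gone; `act`, `n`, `clip` the family's), row NE5's END binders for the READ-OUT FAMILY as in `NE4ReadOutSocket` §1
  (W1 entrywise, W4 posited — the produced-W4 / tower-split feeds of the siblings compose identically), and (R) on classes.
* §2 `injectedRate_of_gaussNE9_endNE5` — node U2's OUTPUT `T4CauchySum.InjectedRate (2(cr·C₅·θ₅)/(1 − ρ)) 0 ρ (disc of the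
  runs)` by `T4CurrencyMatching.injectedRate_of_runs_by` in the currency `invSq` — weight `1`, window
  `cr·(ℓ/ν)·ν·ρ/(ρ − ν) ≤ (1 − ρ)/2` (no `γ³/2`), NO asymptotic-freedom lower bound; verbatim the binder `hinj` of
  `T4TowerRateDischarge.uRateUpTo_of_nodes` and of `T4CurrencyMatching.uRateUpTo_towerT` (the spine's `K`-uniform
  `URateUpTo K` on t-histories follows from §2 by the latter exactly as `NE4ReadOutSocket` §3 does in the g-currency; not
  restated here for length).

WHAT REMAINS DISPLAYED AT NODE U2 through this face: NOT PRINTED — row NE9's table-channel clause `TwoPointKP`, channel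
coupling modulus `hTcup`, explicit-part modulus, `DecayExtract`/`PinBudget`, occupation `hocc` (PROOF-INTERIOR of (B) per row
NE9) and, for the coupling channel, per index the three printed-TYPE statements + measurability + tilt admissibility + the
two comparisons with the common majorant (row NE9's residual line `M₀·Π ≤ (2.38)-majorant`); row NE5's walls W1/W2/W3/W4/
MI-R; printed STRUCTURE — `hA`/`hB`, `ScaleZeroFree`…`Factorises`, `hrepr`; printed TYPE, unprinted number — `cr`; node U1/H3
— runs/box/pin; CONDITIONAL-CELL — (B)/(B^μ)/BetaPertH inside `W`/`Wt`; scalars — memory gap `ν < ρ`, window, S, reach; the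
instantiation SHAPE of the Gaussian family (one fluctuation space per polymer, one scalar bond functional per cut-off bond).

WHAT IS PROVED: bookkeeping only (`subst` of displayed abbreviations, compositions of LANDED theorems BY NAME).  0 sorry;
axioms ⊆ {propext, Classical.choice, Quot.sound}; imports `Support/NE4ReadOutSocket` (p202738) and
`Support/NE4GaussianCouplingTwoPoint` only and modifies nothing.  NOT COVERED: any instance of a binder for Bałaban's objects;
NE2, NE3, NE5, NE9, BetaPertH, (B), (B^μ); the g-form of the history moduli.  Rung (B)+1 finite T⁴; NOT summit progress.
-/

noncomputable section

namespace Summit.QuantumFields.BalabanUV.T4Continuum.NE4ReadOutSocketGaussian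

open MeasureTheory ProbabilityTheory
open scoped BigOperators RealInnerProductSpace
open Literature.MathematicalPhysics.QuantumFieldTheory.Balaban1983to89
open FlowStep (HBeta RGEqH Box)
open T4OutputRate (Carriers Functional NE5 NE9 DecayBound)
open T4CouplingMatching (disc ScaleShiftRate)
open T4CauchySum (InjectedRate)
open T4CurrencyMatching (HistLipschitzBy invSq reparam)
open T4BetaReadOut (Slice ReadOut RepresentsA RepresentsB SliceClose)
open T4BetaReadOutLipschitz (ReadBoundedOn ReadCovariantOn scaleShiftRate_of_ne5_on)
open T4FlagMemory (extd extd_coe)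
open T4HistoryLipschitzRecursion (prodModuli ScaleZeroFree AdmissibleTerms AdmRestrict ChannelAdditive ChannelStepSum
  ChannelSizeAtStepNN)
open T4HistoryLipschitzOuter (Factorises)
open T4HistoryLipschitzActivity (ClusterGeom)
open T4HistoryLipschitzSegment (TwoPointKP)
open T4InputCauchyRateData (StepModel)
open T4OperatorRateLiaison (EntrywiseRate)
open NE9LastCouplingBridge (ne9_and_fadingMemory_of_couplingTwoPoint)
open OutputRateResidual (ne5_at_of_entrywise_lip_nat)
open NE9CouplingTwoPoint (formAct)
open NE9LocalTwoPoint (cutoffLF)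
open NE9DilatedTables (smallFieldPolydisc dilationDomain dilTables)
open NE9TiltedProduct (tiltConst)
open NE4GaussianCouplingTwoPoint (couplingTwoPoint_of_gaussian)

variable {C : Carriers}

/-! ## §0 The read-out (R) on a class, in a currency φ of the histories -/

/-- **HISTORY MODULI OF β IN THE CURRENCY φ FROM NE9 OF THE φ-PARAMETRISED FAMILY, read-out restricted to a class
(kernel).**  `T4CurrencyMatching.histLipschitzBy_of_ne9` with the read-out bound assumed only on a class `𝒜` containing
the re-parametrised slices of the padded box histories (`T4BetaReadOutLipschitz.histLipschitz_of_ne9_on` is the case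
`φ = id`).  Bookkeeping over UNPRINTED inputs. [folklore] -/
theorem histLipschitzBy_of_ne9_on {Bg : Type} {φ : ℝ → ℝ} {Wφ : Set (ℕ → ℝ)} {Eφ : Functional C Bg}
    {𝒜 : Set (Slice C Bg)} {r : ReadOut C Bg} {β : HBeta} {γ κ cr : ℝ} {Λ : ℕ → ℕ → ℝ}
    (hWφ : ∀ k (v : Fin (k + 1) → ℝ), v ∈ Box γ k → (fun m => φ (extd v m)) ∈ Wφ)
    (h9 : NE9 Eφ Wφ κ Λ) (hA : RepresentsA (reparam φ Eφ) r γ β)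
    (h𝒜 : ∀ k (v : Fin (k + 1) → ℝ), v ∈ Box γ k → reparam φ Eφ (extd v) ∈ 𝒜) (hr : ReadBoundedOn 𝒜 r κ cr) :
    HistLipschitzBy φ (fun k i => cr * Λ (k + 1) i) γ β := by
  intro k p q hp hq
  set S : ℝ := ∑ i : Fin (k + 1), Λ (k + 1) i * |φ (p i) - φ (q i)| with hS
  have hclose : SliceClose κ k (reparam φ Eφ (extd p)) (reparam φ Eφ (extd q)) S := by
    intro U X hX
    have h := h9 _ (hWφ k p hp) _ (hWφ k q hq) U X
    rw [hX] at h
    have hsum : ∑ i ∈ Finset.range (k + 1), Λ (k + 1) i * |φ (extd p i) - φ (extd q i)| = S := by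
      rw [hS, ← Fin.sum_univ_eq_sum_range (fun i => Λ (k + 1) i * |φ (extd p i) - φ (extd q i)|) (k + 1)]
      simp only [extd_coe]
    rw [hsum, mul_comm] at h
    exact h
  have hread := hr k _ _ S (h𝒜 k p hp) (h𝒜 k q hq) hclose
  calc |β k p - β k q| = |r k (reparam φ Eφ (extd p)) - r k (reparam φ Eφ (extd q))| := by
        rw [hA k p hp, hA k q hq]
    _ ≤ cr * S := hread
    _ = ∑ i : Fin (k + 1), cr * Λ (k + 1) i * |φ (p i) - φ (q i)| := by
        rw [hS, Finset.mul_sum]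
        exact Finset.sum_congr rfl fun i _ => by ring

/-! ## §1 The row's triple at node U2 on t-histories, the coupling channel fed by Gaussian letters -/

/-- **ROW NE4 — NODE U2's TRIPLE WITH ROW NE9's COUPLING TWO-POINT CLAUSE PRODUCED FROM GAUSSIAN LETTERS (t-currency face,
by name).**  Binders: (GAUSS) the family of `NE4GaussianCouplingTwoPoint.couplingTwoPoint_of_gaussian` on run A's backgrounds, with its two
majorant comparisons; (NE9-END, rest) the binders of `NE9LastCouplingBridge.ne9_and_fadingMemory_of_couplingTwoPoint` for a
term family `Et` of the t-HISTORY over a t-window `Wt` (floor `γ⁻²`, containing the t-images of the padded box histories)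
VERBATIM except `hCup` (produced) — `act`, `n`, `clip` are now the Gaussian activities, the common majorant and the modulus
ratio of (GAUSS); (NE5-END, read-out family) the binders of `OutputRateResidual.ne5_at_of_entrywise_lip_nat` for the pair
(`reparam invSq Et`, `EBfam b′`) over the coupling window `W`, datum-indexed step models `Mf b′`, datum-free scalars — as in
`NE4ReadOutSocket.ne4_of_endNE9_endNE5`; (R) on classes, the β-functions read from `reparam invSq Et`.  Conclusion: node U2's
triple with the history moduli in the currency `t = g⁻²` — `ScaleShiftRate (cr·C₅·θ₅) θ₅ γ β ∧
T4CurrencyMatching.HistLipschitzBy invSq (cr·Λ(·+1)) γ β ∧ T4CouplingMatching.FadingMemory (cr·(ℓ/ν)·ν) ν (cr·Λ(·+1))`.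
The g-form of the second member does NOT follow from Gaussian/analytic letters (tree no-go
`T4CouplingAnalyticity.exists_couplingAnalyticRel_not_ne9Window`); node U2 consumes the t-form (§2). [folklore] -/
theorem ne4T_of_gaussNE9_endNE5 (G : ClusterGeom C) {Pot : Type*} [NormedAddCommGroup Pot] [NormedSpace ℂ Pot]
    -- ===== (GAUSS) the Gaussian letters of the coupling channel, per index =====
    {ED : G.P → Type*} [∀ p, NormedAddCommGroup (ED p)] [∀ p, InnerProductSpace ℝ (ED p)]
    [∀ p, FiniteDimensional ℝ (ED p)] [∀ p, MeasurableSpace (ED p)] [∀ p, BorelSpace (ED p)]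
    {TT : ℕ → C.BgA → (p : G.P) → ED p →ₗ[ℝ] ED p} (hT : ∀ k U p, (TT k U p).IsSymmetric) {nD : G.P → ℕ}
    (hn : ∀ p, Module.finrank ℝ (ED p) = nD p) {Bd : G.P → Type*} [∀ p, DecidableEq (Bd p)]
    {sb lb ab : (p : G.P) → Finset (Bd p)} (ub : ℕ → C.BgA → (p : G.P) → Bd p → ED p)
    {Wc : G.P → Type*} [∀ p, NormedAddCommGroup (Wc p)] [∀ p, NormedSpace ℂ (Wc p)] {Vc : Type*} [NormedAddCommGroup Vc]
    [NormedSpace ℂ Vc] {φc : ℕ → C.BgA → (p : G.P) → ED p → Wc p} {ℓc : (p : G.P) → Bd p → Wc p →L[ℂ] Vc} {TM : Type*}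
    {terms : G.P → Finset TM} {ac : TM → ℂ → ℂ} {F : ℕ → C.BgA → Pot → (p : G.P) → TM → Wc p → ℂ}
    {pre : ℕ → C.BgA → Pot → (p : G.P) → ED p → ℂ} {e e₁ : ℕ → C.BgA → Pot → (p : G.P) → ED p → ℝ}
    {hh : ℕ → C.BgA → Pot → (p : G.P) → ED p} {α M₀ M₁ : ℕ → C.BgA → Pot → G.P → ℝ} {ε₁ c γ : ℝ}
    {𝒜 : ℕ → Set Pot} {Idx : ℕ → C.BgA → Pot → G.P → Prop} {Wt : Set (ℕ → ℝ)}
    {act : ℕ → ℝ → C.BgA → Pot → G.P → ℂ} {n : ℕ → ℝ → C.BgA → G.P → ℝ} {clip : ℕ → ℝ}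
    (hIdx : ∀ (k : ℕ) (U : C.BgA) (X : C.Dom), C.scale X = k + 1 → ∀ Q ∈ 𝒜 k, ∀ p ∈ G.vol X, Idx k U Q p)
    (hact : ∀ k t U Q p, act k t U Q p = formAct (stdGaussian (ED p))
      (cutoffLF (sb p) (lb p) (fun b (z : ED p) => ⟪ub k U p b, TT k U p z⟫) ε₁) (pre k U Q p)
      (fun x z => dilTables (terms p) ac (F k U Q p) (φc k U p) x z) (Real.sqrt t)⁻¹)
    (hWtfloor : ∀ g ∈ Wt, ∀ k, (γ ^ 2)⁻¹ ≤ g k) (hε : 0 ≤ ε₁) (hc : 0 < c) (hγ : 0 < γ) (hab : ∀ p, ab p ⊆ sb p)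
    (ha : ∀ s s', 0 < s → s ≤ γ → 0 < s' → s' ≤ γ →
      ∀ m, DifferentiableOn ℂ (ac m) (dilationDomain (min s s') (max s s') (c * min s s')))
    (hα0 : ∀ k U Q p, Idx k U Q p → 0 ≤ α k U Q p)
    (hα : ∀ k U Q p, Idx k U Q p → ∀ i, α k U Q p * ((hT k U p).eigenvalues (hn p) i) ^ 2 < 1)
    (hub : ∀ k U Q p, Idx k U Q p → ∀ b ∈ sb p ∪ lb p, TT k U p (ub k U p b) ≠ 0)
    (hprem : ∀ k U Q p, Idx k U Q p → Measurable (pre k U Q p))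
    (hem : ∀ k U Q p, Idx k U Q p → Measurable (e k U Q p)) (he₁m : ∀ k U Q p, Idx k U Q p → Measurable (e₁ k U Q p))
    (hVs : ∀ k U Q p, Idx k U Q p → ∀ s, 0 < s → s ≤ γ →
      AEStronglyMeasurable (fun z => dilTables (terms p) ac (F k U Q p) (φc k U p) s z) (stdGaussian (ED p)))
    (he₁ : ∀ k U Q p, Idx k U Q p → ∀ z, 0 ≤ e₁ k U Q p z)
    (hM₀ : ∀ k U Q p, Idx k U Q p → 0 ≤ M₀ k U Q p) (hM₁ : ∀ k U Q p, Idx k U Q p → 0 ≤ M₁ k U Q p)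
    (hlink : ∀ k U Q p, Idx k U Q p → ∀ z, ∀ b ∈ ab p, ‖ℓc p b (φc k U p z)‖ ≤ |⟪ub k U p b, TT k U p z⟫|)
    (hF : ∀ k U Q p, Idx k U Q p → ∀ m ∈ terms p,
      DifferentiableOn ℂ (F k U Q p m) (smallFieldPolydisc (ab p) (ℓc p) ((1 + c) * ε₁)))
    (hbd : ∀ k U Q p, Idx k U Q p → ∀ s, 0 < s → s ≤ γ →
      ∀ z ∈ cutoffLF (sb p) (lb p) (fun b (z : ED p) => ⟪ub k U p b, TT k U p z⟫) ε₁ s,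
        ‖dilTables (terms p) ac (F k U Q p) (φc k U p) s z‖ ≤ e k U Q p z)
    (hdil : ∀ k U Q p, Idx k U Q p → ∀ s s', 0 < s → s ≤ γ → 0 < s' → s' ≤ γ →
      ∀ z ∈ cutoffLF (sb p) (lb p) (fun b (z : ED p) => ⟪ub k U p b, TT k U p z⟫) ε₁ s ∩
          cutoffLF (sb p) (lb p) (fun b (z : ED p) => ⟪ub k U p b, TT k U p z⟫) ε₁ s',
        ∀ ζ ∈ dilationDomain (min s s') (max s s') (c * min s s'),
          ‖dilTables (terms p) ac (F k U Q p) (φc k U p) ζ z‖ ≤ e₁ k U Q p z)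
    (hdom₀ : ∀ k U Q p, Idx k U Q p → ∀ z, ‖pre k U Q p z‖ * Real.exp (e k U Q p z) ≤
      M₀ k U Q p * Real.exp (α k U Q p / 2 * ‖TT k U p z‖ ^ 2 + ⟪hh k U Q p, TT k U p z⟫))
    (hdom₁ : ∀ k U Q p, Idx k U Q p → ∀ z, ‖pre k U Q p z‖ * e₁ k U Q p z * Real.exp (e k U Q p z) ≤
      M₁ k U Q p * Real.exp (α k U Q p / 2 * ‖TT k U p z‖ ^ 2 + ⟪hh k U Q p, TT k U p z⟫))
    (hsize : ∀ k U Q p, Idx k U Q p → ∀ t', (γ ^ 2)⁻¹ ≤ t' →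
      M₀ k U Q p * ∏ i, tiltConst (α k U Q p * ((hT k U p).eigenvalues (hn p) i) ^ 2)
        ((hT k U p).eigenvalues (hn p) i * ⟪hh k U Q p, (hT k U p).eigenvectorBasis (hn p) i⟫) ≤ n k t' U p)
    (hmod : ∀ k U Q p, Idx k U Q p → ∀ t', (γ ^ 2)⁻¹ ≤ t' →
      4 * (M₁ k U Q p * ∏ i, tiltConst (α k U Q p * ((hT k U p).eigenvalues (hn p) i) ^ 2)
            ((hT k U p).eigenvalues (hn p) i * ⟪hh k U Q p, (hT k U p).eigenvectorBasis (hn p) i⟫)) / c * (γ ^ 2 / 2) +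
        (∑ b ∈ sb p ∪ lb p, M₀ k U Q p *
            (∏ i, tiltConst (α k U Q p * ((hT k U p).eigenvalues (hn p) i) ^ 2)
              ((hT k U p).eigenvalues (hn p) i * ⟪hh k U Q p, (hT k U p).eigenvectorBasis (hn p) i⟫)) *
            (2 * ε₁ * (Real.sqrt (2 * Real.pi * ‖TT k U p (ub k U p b)‖ ^ 2))⁻¹)) * (γ / 2) ≤
        clip k * n k t' U p)
    -- ===== (NE9-END, rest) the other binders of `ne9_and_fadingMemory_of_couplingTwoPoint`, on t-histories =====
    {ιc : Type} {Et : Functional C C.BgA} {Adm : Set (C.BgA → C.Dom → ℝ)}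
    {Tc : ℕ → (ℕ → ℝ) → (C.BgA → C.Dom → ℝ) → ιc → ℝ} {Ψ : ℕ → ℝ → (ιc → ℝ) → C.BgA → C.Dom → ℝ}
    {lip : ℕ → ℝ} {aP dP : G.P → ℝ} {δ : C.Dom → ℝ} {κ B lipbar clipbar pexbar qTbar τbar ω ℓ ν : ℝ}
    {wt : ℕ → ιc → ℝ} {τ : ℕ → ℕ → ℝ} {pex qT : ℕ → ℝ} (ρT : ℕ → (ιc → ℝ) → Pot)
    (expl : ℕ → ℝ → C.BgA → C.Dom → ℝ)
    (h0 : ScaleZeroFree Et Wt) (hAdm : AdmissibleTerms Et Wt Adm) (hres : AdmRestrict Adm) (hadd : ChannelAdditive Adm Tc)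
    (hsum : ChannelStepSum Adm Tc) (hstep : ChannelSizeAtStepNN Adm Tc κ wt τ) (hfac : Factorises Et Wt Tc Ψ)
    (hclip0 : ∀ k, 0 ≤ clip k) (hqT0 : ∀ k, 0 ≤ qT k)
    (hTcup : ∀ g ∈ Wt, ∀ g' ∈ Wt, ∀ (k : ℕ) (y : ιc), |Tc k g (Et g) y - Tc k g' (Et g) y| ≤ wt k y * (qT k * |g k - g' k|))
    (hrepr : ∀ (k : ℕ) (s : ℝ) (P : ιc → ℝ) (U : C.BgA) (X : C.Dom),
      Ψ k s P U X = (G.newTerm act k s U X (ρT k P)).re + expl k s U X)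
    (hexpl : ∀ g ∈ Wt, ∀ g' ∈ Wt, ∀ (k : ℕ) (U : C.BgA) (X : C.Dom), C.scale X = k + 1 →
      |expl k (g k) U X - expl k (g' k) U X| ≤ Real.exp (-(κ * C.d X)) * (pex k * |g k - g' k|))
    (hclipb : ∀ k, clip k ≤ clipbar) (hpexb : ∀ k, pex k ≤ pexbar) (hpexbar : 0 ≤ pexbar) (hqTb : ∀ k, qT k ≤ qTbar)
    (hKP : TwoPointKP G Wt act 𝒜 n lip aP dP) (hdec : G.DecayExtract δ dP) (hpinB : G.PinBudget aP δ (fun _ => B) κ)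
    (hρT : ∀ (k : ℕ) (P P' : ιc → ℝ) (M : ℝ), (∀ y, |P y - P' y| ≤ wt k y * M) → ‖ρT k P - ρT k P'‖ ≤ M)
    (hocc : ∀ g ∈ Wt, ∀ g' ∈ Wt, ∀ k : ℕ, ρT k (Tc k g' (Et g)) ∈ 𝒜 k) (hB0 : 0 ≤ B)
    (hlipb : ∀ k, lip k ≤ lipbar) (hτbar : 0 ≤ τbar) (hω : 0 ≤ ω) (hpos : 0 < ω + 4 * lipbar * B * τbar)
    (hτ : ∀ k j, j ≤ k → 0 ≤ τ k j ∧ τ k j ≤ τbar * ω ^ (k - j))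
    (hℓ : 4 * clipbar * B + pexbar + 4 * lipbar * B * qTbar = ℓ) (hν : ω + 4 * lipbar * B * τbar = ν)
    -- ===== (NE5-END) for the read-out family (`reparam invSq Et`, `EBfam b′`) over the coupling window `W` =====
    {S Hist : Type*} [Fintype S] [NormedAddCommGroup Hist] [NormedSpace ℂ Hist] (Mf : ℝ → StepModel C (S → ℂ) Hist)
    {W : Set (ℕ → ℝ)} {EBfam : ℝ → Functional C C.BgB} {Λ₅ EA₀ E₀ c₁ r₀ δ₅ θ₁ θ₅ c₅ ω₅ ρ₀ B₅ C₅ : ℝ} {rf : ℕ → S → ℝ}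
    {k₅ : ℕ} (hdA : DecayBound (reparam invSq Et) W EA₀ κ) (hunit : ∀ k s, rf k s ≤ θ₁ ^ k) (hr₀ : 0 < r₀)
    (hc₁ : 0 ≤ c₁) (hrAf : ∀ b', 0 < b' → b' ≤ γ → (Mf b').RepresentsA (reparam invSq Et) W)
    (hrBf : ∀ b', 0 < b' → b' ≤ γ → (Mf b').RepresentsB (EBfam b') W)
    (hbasef : ∀ b', 0 < b' → b' ≤ γ → (Mf b').InBase (EBfam b') W)
    (hlipf : ∀ b', 0 < b' → b' ≤ γ → (Mf b').DataLipschitz W κ Λ₅ ρ₀)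
    (hdBf : ∀ b', 0 < b' → b' ≤ γ → DecayBound (EBfam b') W E₀ κ)
    (hentf : ∀ b', 0 < b' → b' ≤ γ → EntrywiseRate (Mf b') W c₁ rf)
    (hflf : ∀ b', 0 < b' → b' ≤ γ → ∀ k, r₀ ≤ (Mf b').rOp k)
    (hinsf : ∀ b', 0 < b' → b' ≤ γ → (Mf b').InsertionRate W κ E₀ δ₅ θ₁)
    (hdampf : ∀ b', 0 < b' → b' ≤ γ → (Mf b').InsertionDampedNat W κ c₅ ω₅)
    (hΛ₅ : 0 ≤ Λ₅) (hδ₅ : 0 ≤ δ₅) (hθ₁ : 0 ≤ θ₁) (hθ₁₅ : θ₁ ≤ θ₅) (hθ₅1 : θ₅ ≤ 1) (hc₅ : 0 ≤ c₅) (hω₅ : 0 < ω₅)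
    (hnear : (c₁ / r₀ + δ₅) * θ₁ ^ k₅ + c₅ * (EA₀ + E₀) / (1 - ω₅) ≤ ρ₀) (hB₅ : 0 ≤ B₅)
    (hfirst : ∀ k < k₅, EA₀ + E₀ ≤ B₅ * θ₁ ^ k) (hsmall5 : ω₅ + Λ₅ * c₅ < θ₅)
    (hC₅ : (Λ₅ * (c₁ / r₀ + δ₅) + B₅) * (θ₅ - ω₅) / (θ₅ - (ω₅ + Λ₅ * c₅)) = C₅)
    -- ===== node U2's read-out (R) on classes, β read from the t-parametrised family =====
    {𝒜A : Set (Slice C C.BgA)} {𝒜B : Set (Slice C C.BgB)} {rA : ReadOut C C.BgA} {rB : ReadOut C C.BgB} {β : HBeta}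
    {cr : ℝ} (hW : ∀ k (v : Fin (k + 1) → ℝ), v ∈ Box γ k → extd v ∈ W)
    (hWt : ∀ k (v : Fin (k + 1) → ℝ), v ∈ Box γ k → (fun m => invSq (extd v m)) ∈ Wt)
    (hA : RepresentsA (reparam invSq Et) rA γ β) (hB : RepresentsB EBfam rB γ β)
    (h𝒜A : ∀ g' ∈ W, reparam invSq Et g' ∈ 𝒜A) (h𝒜B : ∀ b', 0 < b' → b' ≤ γ → ∀ g' ∈ W, EBfam b' g' ∈ 𝒜B)
    (hr : ReadBoundedOn 𝒜A rA κ cr) (hcov : ReadCovariantOn 𝒜A 𝒜B rA rB κ cr) (hcr : 0 ≤ cr) :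
    ScaleShiftRate (cr * C₅ * θ₅) θ₅ γ β ∧
      HistLipschitzBy invSq (fun k i => cr * prodModuli ℓ (fun _ => ν) (k + 1) i) γ β ∧
        T4CouplingMatching.FadingMemory (cr * (ℓ / ν) * ν) ν (fun k i => cr * prodModuli ℓ (fun _ => ν) (k + 1) i) := by
  subst hℓ hν hC₅
  have hCup := couplingTwoPoint_of_gaussian G hT hn ub hIdx hact hWtfloor hε hc hγ hab ha hα0 hα hub hprem hem he₁m hVs
    he₁ hM₀ hM₁ hlink hF hbd hdil hdom₀ hdom₁ hsize hmod
  have hK := ne9_and_fadingMemory_of_couplingTwoPoint G ρT expl h0 hAdm hres hadd hsum hstep hfac hclip0 hCup hqT0 hTcup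
    hrepr hexpl hclipb hpexb hpexbar hqTb hKP hdec hpinB hρT hocc hB0 hlipb hτbar hω hpos hτ
  exact ⟨scaleShiftRate_of_ne5_on hW
      (fun b' hb hbγ => ne5_at_of_entrywise_lip_nat (Mf b') (hrAf b' hb hbγ) (hrBf b' hb hbγ) (hbasef b' hb hbγ)
        (hlipf b' hb hbγ) hdA (hdBf b' hb hbγ) (hentf b' hb hbγ) hunit (hflf b' hb hbγ) hr₀ hc₁ (hinsf b' hb hbγ)
        (hdampf b' hb hbγ) hΛ₅ hδ₅ hθ₁ hθ₁₅ hθ₅1 hc₅ hω₅ hnear hB₅ hfirst hsmall5)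
      hA hB h𝒜A h𝒜B hcov,
    histLipschitzBy_of_ne9_on hWt hK.1 hA (fun k v hv => h𝒜A _ (hW k v hv)) hr,
    T4BetaReadOut.fadingMemory_readOut hK.2 hcr⟩


/-! ## §2 Node U2's output in the spine's currency from the t-form (weight 1, no γ³, no asymptotic-freedom input) -/

/-- **ROW NE4 — NODE U2's OUTPUT `InjectedRate` WITH THE COUPLING CHANNEL FED BY GAUSSIAN LETTERS (by name).**  §1's
binders plus node U1/H3's IR-pinned runs of (0.20) with history in the box (`hrun`, `hbox`, `hpin`), the rates `θ₅ ≤ ρ`,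
the memory gap `ν < ρ`, `0 < ρ < 1`, and the ONE window `cr·(ℓ/ν)·ν·ρ/(ρ − ν) ≤ (1 − ρ)/2` — weight `1` of the
t-currency (`T4CurrencyMatching.currencyWeight_invSq`), NOT the g-currency's `γ³/2` of `NE4ReadOutSocket.injectedRate_of_endNE9_endNE5`;
conclusion `T4CauchySum.InjectedRate (2(cr·C₅·θ₅)/(1 − ρ)) 0 ρ (disc of the runs)` by
`T4CurrencyMatching.injectedRate_of_runs_by` on §1's triple — verbatim the binder `hinj` of
`T4TowerRateDischarge.uRateUpTo_of_nodes` / `T4CurrencyMatching.uRateUpTo_towerT`.  NO `EventualLowerH`.  Every hypothesis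
UNPRINTED or conditional; nothing of [Balaban1987RG1] is asserted. [folklore] -/
theorem injectedRate_of_gaussNE9_endNE5 (G : ClusterGeom C) {Pot : Type*} [NormedAddCommGroup Pot] [NormedSpace ℂ Pot]
    -- ===== (GAUSS) the Gaussian letters of the coupling channel, per index =====
    {ED : G.P → Type*} [∀ p, NormedAddCommGroup (ED p)] [∀ p, InnerProductSpace ℝ (ED p)]
    [∀ p, FiniteDimensional ℝ (ED p)] [∀ p, MeasurableSpace (ED p)] [∀ p, BorelSpace (ED p)]
    {TT : ℕ → C.BgA → (p : G.P) → ED p →ₗ[ℝ] ED p} (hT : ∀ k U p, (TT k U p).IsSymmetric) {nD : G.P → ℕ}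
    (hn : ∀ p, Module.finrank ℝ (ED p) = nD p) {Bd : G.P → Type*} [∀ p, DecidableEq (Bd p)]
    {sb lb ab : (p : G.P) → Finset (Bd p)} (ub : ℕ → C.BgA → (p : G.P) → Bd p → ED p)
    {Wc : G.P → Type*} [∀ p, NormedAddCommGroup (Wc p)] [∀ p, NormedSpace ℂ (Wc p)] {Vc : Type*} [NormedAddCommGroup Vc]
    [NormedSpace ℂ Vc] {φc : ℕ → C.BgA → (p : G.P) → ED p → Wc p} {ℓc : (p : G.P) → Bd p → Wc p →L[ℂ] Vc} {TM : Type*}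
    {terms : G.P → Finset TM} {ac : TM → ℂ → ℂ} {F : ℕ → C.BgA → Pot → (p : G.P) → TM → Wc p → ℂ}
    {pre : ℕ → C.BgA → Pot → (p : G.P) → ED p → ℂ} {e e₁ : ℕ → C.BgA → Pot → (p : G.P) → ED p → ℝ}
    {hh : ℕ → C.BgA → Pot → (p : G.P) → ED p} {α M₀ M₁ : ℕ → C.BgA → Pot → G.P → ℝ} {ε₁ c γ : ℝ}
    {𝒜 : ℕ → Set Pot} {Idx : ℕ → C.BgA → Pot → G.P → Prop} {Wt : Set (ℕ → ℝ)}
    {act : ℕ → ℝ → C.BgA → Pot → G.P → ℂ} {n : ℕ → ℝ → C.BgA → G.P → ℝ} {clip : ℕ → ℝ}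
    (hIdx : ∀ (k : ℕ) (U : C.BgA) (X : C.Dom), C.scale X = k + 1 → ∀ Q ∈ 𝒜 k, ∀ p ∈ G.vol X, Idx k U Q p)
    (hact : ∀ k t U Q p, act k t U Q p = formAct (stdGaussian (ED p))
      (cutoffLF (sb p) (lb p) (fun b (z : ED p) => ⟪ub k U p b, TT k U p z⟫) ε₁) (pre k U Q p)
      (fun x z => dilTables (terms p) ac (F k U Q p) (φc k U p) x z) (Real.sqrt t)⁻¹)
    (hWtfloor : ∀ g ∈ Wt, ∀ k, (γ ^ 2)⁻¹ ≤ g k) (hε : 0 ≤ ε₁) (hc : 0 < c) (hγ : 0 < γ) (hab : ∀ p, ab p ⊆ sb p)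
    (ha : ∀ s s', 0 < s → s ≤ γ → 0 < s' → s' ≤ γ →
      ∀ m, DifferentiableOn ℂ (ac m) (dilationDomain (min s s') (max s s') (c * min s s')))
    (hα0 : ∀ k U Q p, Idx k U Q p → 0 ≤ α k U Q p)
    (hα : ∀ k U Q p, Idx k U Q p → ∀ i, α k U Q p * ((hT k U p).eigenvalues (hn p) i) ^ 2 < 1)
    (hub : ∀ k U Q p, Idx k U Q p → ∀ b ∈ sb p ∪ lb p, TT k U p (ub k U p b) ≠ 0)
    (hprem : ∀ k U Q p, Idx k U Q p → Measurable (pre k U Q p))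
    (hem : ∀ k U Q p, Idx k U Q p → Measurable (e k U Q p)) (he₁m : ∀ k U Q p, Idx k U Q p → Measurable (e₁ k U Q p))
    (hVs : ∀ k U Q p, Idx k U Q p → ∀ s, 0 < s → s ≤ γ →
      AEStronglyMeasurable (fun z => dilTables (terms p) ac (F k U Q p) (φc k U p) s z) (stdGaussian (ED p)))
    (he₁ : ∀ k U Q p, Idx k U Q p → ∀ z, 0 ≤ e₁ k U Q p z)
    (hM₀ : ∀ k U Q p, Idx k U Q p → 0 ≤ M₀ k U Q p) (hM₁ : ∀ k U Q p, Idx k U Q p → 0 ≤ M₁ k U Q p)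
    (hlink : ∀ k U Q p, Idx k U Q p → ∀ z, ∀ b ∈ ab p, ‖ℓc p b (φc k U p z)‖ ≤ |⟪ub k U p b, TT k U p z⟫|)
    (hF : ∀ k U Q p, Idx k U Q p → ∀ m ∈ terms p,
      DifferentiableOn ℂ (F k U Q p m) (smallFieldPolydisc (ab p) (ℓc p) ((1 + c) * ε₁)))
    (hbd : ∀ k U Q p, Idx k U Q p → ∀ s, 0 < s → s ≤ γ →
      ∀ z ∈ cutoffLF (sb p) (lb p) (fun b (z : ED p) => ⟪ub k U p b, TT k U p z⟫) ε₁ s,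
        ‖dilTables (terms p) ac (F k U Q p) (φc k U p) s z‖ ≤ e k U Q p z)
    (hdil : ∀ k U Q p, Idx k U Q p → ∀ s s', 0 < s → s ≤ γ → 0 < s' → s' ≤ γ →
      ∀ z ∈ cutoffLF (sb p) (lb p) (fun b (z : ED p) => ⟪ub k U p b, TT k U p z⟫) ε₁ s ∩
          cutoffLF (sb p) (lb p) (fun b (z : ED p) => ⟪ub k U p b, TT k U p z⟫) ε₁ s',
        ∀ ζ ∈ dilationDomain (min s s') (max s s') (c * min s s'),
          ‖dilTables (terms p) ac (F k U Q p) (φc k U p) ζ z‖ ≤ e₁ k U Q p z)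
    (hdom₀ : ∀ k U Q p, Idx k U Q p → ∀ z, ‖pre k U Q p z‖ * Real.exp (e k U Q p z) ≤
      M₀ k U Q p * Real.exp (α k U Q p / 2 * ‖TT k U p z‖ ^ 2 + ⟪hh k U Q p, TT k U p z⟫))
    (hdom₁ : ∀ k U Q p, Idx k U Q p → ∀ z, ‖pre k U Q p z‖ * e₁ k U Q p z * Real.exp (e k U Q p z) ≤
      M₁ k U Q p * Real.exp (α k U Q p / 2 * ‖TT k U p z‖ ^ 2 + ⟪hh k U Q p, TT k U p z⟫))
    (hsize : ∀ k U Q p, Idx k U Q p → ∀ t', (γ ^ 2)⁻¹ ≤ t' →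
      M₀ k U Q p * ∏ i, tiltConst (α k U Q p * ((hT k U p).eigenvalues (hn p) i) ^ 2)
        ((hT k U p).eigenvalues (hn p) i * ⟪hh k U Q p, (hT k U p).eigenvectorBasis (hn p) i⟫) ≤ n k t' U p)
    (hmod : ∀ k U Q p, Idx k U Q p → ∀ t', (γ ^ 2)⁻¹ ≤ t' →
      4 * (M₁ k U Q p * ∏ i, tiltConst (α k U Q p * ((hT k U p).eigenvalues (hn p) i) ^ 2)
            ((hT k U p).eigenvalues (hn p) i * ⟪hh k U Q p, (hT k U p).eigenvectorBasis (hn p) i⟫)) / c * (γ ^ 2 / 2) +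
        (∑ b ∈ sb p ∪ lb p, M₀ k U Q p *
            (∏ i, tiltConst (α k U Q p * ((hT k U p).eigenvalues (hn p) i) ^ 2)
              ((hT k U p).eigenvalues (hn p) i * ⟪hh k U Q p, (hT k U p).eigenvectorBasis (hn p) i⟫)) *
            (2 * ε₁ * (Real.sqrt (2 * Real.pi * ‖TT k U p (ub k U p b)‖ ^ 2))⁻¹)) * (γ / 2) ≤
        clip k * n k t' U p)
    -- ===== (NE9-END, rest) the other binders of `ne9_and_fadingMemory_of_couplingTwoPoint`, on t-histories =====
    {ιc : Type} {Et : Functional C C.BgA} {Adm : Set (C.BgA → C.Dom → ℝ)}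
    {Tc : ℕ → (ℕ → ℝ) → (C.BgA → C.Dom → ℝ) → ιc → ℝ} {Ψ : ℕ → ℝ → (ιc → ℝ) → C.BgA → C.Dom → ℝ}
    {lip : ℕ → ℝ} {aP dP : G.P → ℝ} {δ : C.Dom → ℝ} {κ B lipbar clipbar pexbar qTbar τbar ω ℓ ν : ℝ}
    {wt : ℕ → ιc → ℝ} {τ : ℕ → ℕ → ℝ} {pex qT : ℕ → ℝ} (ρT : ℕ → (ιc → ℝ) → Pot)
    (expl : ℕ → ℝ → C.BgA → C.Dom → ℝ)
    (h0 : ScaleZeroFree Et Wt) (hAdm : AdmissibleTerms Et Wt Adm) (hres : AdmRestrict Adm) (hadd : ChannelAdditive Adm Tc)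
    (hsum : ChannelStepSum Adm Tc) (hstep : ChannelSizeAtStepNN Adm Tc κ wt τ) (hfac : Factorises Et Wt Tc Ψ)
    (hclip0 : ∀ k, 0 ≤ clip k) (hqT0 : ∀ k, 0 ≤ qT k)
    (hTcup : ∀ g ∈ Wt, ∀ g' ∈ Wt, ∀ (k : ℕ) (y : ιc), |Tc k g (Et g) y - Tc k g' (Et g) y| ≤ wt k y * (qT k * |g k - g' k|))
    (hrepr : ∀ (k : ℕ) (s : ℝ) (P : ιc → ℝ) (U : C.BgA) (X : C.Dom),
      Ψ k s P U X = (G.newTerm act k s U X (ρT k P)).re + expl k s U X)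
    (hexpl : ∀ g ∈ Wt, ∀ g' ∈ Wt, ∀ (k : ℕ) (U : C.BgA) (X : C.Dom), C.scale X = k + 1 →
      |expl k (g k) U X - expl k (g' k) U X| ≤ Real.exp (-(κ * C.d X)) * (pex k * |g k - g' k|))
    (hclipb : ∀ k, clip k ≤ clipbar) (hpexb : ∀ k, pex k ≤ pexbar) (hpexbar : 0 ≤ pexbar) (hqTb : ∀ k, qT k ≤ qTbar)
    (hKP : TwoPointKP G Wt act 𝒜 n lip aP dP) (hdec : G.DecayExtract δ dP) (hpinB : G.PinBudget aP δ (fun _ => B) κ)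
    (hρT : ∀ (k : ℕ) (P P' : ιc → ℝ) (M : ℝ), (∀ y, |P y - P' y| ≤ wt k y * M) → ‖ρT k P - ρT k P'‖ ≤ M)
    (hocc : ∀ g ∈ Wt, ∀ g' ∈ Wt, ∀ k : ℕ, ρT k (Tc k g' (Et g)) ∈ 𝒜 k) (hB0 : 0 ≤ B)
    (hlipb : ∀ k, lip k ≤ lipbar) (hτbar : 0 ≤ τbar) (hω : 0 ≤ ω) (hpos : 0 < ω + 4 * lipbar * B * τbar)
    (hτ : ∀ k j, j ≤ k → 0 ≤ τ k j ∧ τ k j ≤ τbar * ω ^ (k - j))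
    (hℓ : 4 * clipbar * B + pexbar + 4 * lipbar * B * qTbar = ℓ) (hν : ω + 4 * lipbar * B * τbar = ν)
    -- ===== (NE5-END) for the read-out family (`reparam invSq Et`, `EBfam b′`) over the coupling window `W` =====
    {S Hist : Type*} [Fintype S] [NormedAddCommGroup Hist] [NormedSpace ℂ Hist] (Mf : ℝ → StepModel C (S → ℂ) Hist)
    {W : Set (ℕ → ℝ)} {EBfam : ℝ → Functional C C.BgB} {Λ₅ EA₀ E₀ c₁ r₀ δ₅ θ₁ θ₅ c₅ ω₅ ρ₀ B₅ C₅ : ℝ} {rf : ℕ → S → ℝ}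
    {k₅ : ℕ} (hdA : DecayBound (reparam invSq Et) W EA₀ κ) (hunit : ∀ k s, rf k s ≤ θ₁ ^ k) (hr₀ : 0 < r₀)
    (hc₁ : 0 ≤ c₁) (hrAf : ∀ b', 0 < b' → b' ≤ γ → (Mf b').RepresentsA (reparam invSq Et) W)
    (hrBf : ∀ b', 0 < b' → b' ≤ γ → (Mf b').RepresentsB (EBfam b') W)
    (hbasef : ∀ b', 0 < b' → b' ≤ γ → (Mf b').InBase (EBfam b') W)
    (hlipf : ∀ b', 0 < b' → b' ≤ γ → (Mf b').DataLipschitz W κ Λ₅ ρ₀)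
    (hdBf : ∀ b', 0 < b' → b' ≤ γ → DecayBound (EBfam b') W E₀ κ)
    (hentf : ∀ b', 0 < b' → b' ≤ γ → EntrywiseRate (Mf b') W c₁ rf)
    (hflf : ∀ b', 0 < b' → b' ≤ γ → ∀ k, r₀ ≤ (Mf b').rOp k)
    (hinsf : ∀ b', 0 < b' → b' ≤ γ → (Mf b').InsertionRate W κ E₀ δ₅ θ₁)
    (hdampf : ∀ b', 0 < b' → b' ≤ γ → (Mf b').InsertionDampedNat W κ c₅ ω₅)
    (hΛ₅ : 0 ≤ Λ₅) (hδ₅ : 0 ≤ δ₅) (hθ₁ : 0 ≤ θ₁) (hθ₁₅ : θ₁ ≤ θ₅) (hθ₅1 : θ₅ ≤ 1) (hc₅ : 0 ≤ c₅) (hω₅ : 0 < ω₅)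
    (hnear : (c₁ / r₀ + δ₅) * θ₁ ^ k₅ + c₅ * (EA₀ + E₀) / (1 - ω₅) ≤ ρ₀) (hB₅ : 0 ≤ B₅)
    (hfirst : ∀ k < k₅, EA₀ + E₀ ≤ B₅ * θ₁ ^ k) (hsmall5 : ω₅ + Λ₅ * c₅ < θ₅)
    (hC₅ : (Λ₅ * (c₁ / r₀ + δ₅) + B₅) * (θ₅ - ω₅) / (θ₅ - (ω₅ + Λ₅ * c₅)) = C₅)
    -- ===== node U2's read-out (R) on classes, β read from the t-parametrised family =====
    {𝒜A : Set (Slice C C.BgA)} {𝒜B : Set (Slice C C.BgB)} {rA : ReadOut C C.BgA} {rB : ReadOut C C.BgB} {β : HBeta}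
    {cr : ℝ} (hW : ∀ k (v : Fin (k + 1) → ℝ), v ∈ Box γ k → extd v ∈ W)
    (hWt : ∀ k (v : Fin (k + 1) → ℝ), v ∈ Box γ k → (fun m => invSq (extd v m)) ∈ Wt)
    (hA : RepresentsA (reparam invSq Et) rA γ β) (hB : RepresentsB EBfam rB γ β)
    (h𝒜A : ∀ g' ∈ W, reparam invSq Et g' ∈ 𝒜A) (h𝒜B : ∀ b', 0 < b' → b' ≤ γ → ∀ g' ∈ W, EBfam b' g' ∈ 𝒜B)
    (hr : ReadBoundedOn 𝒜A rA κ cr) (hcov : ReadCovariantOn 𝒜A 𝒜B rA rB κ cr) (hcr : 0 ≤ cr)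
    -- ===== node U1/H3's runs, the rates and the window (weight 1) =====
    {ρ : ℝ} (g : ℕ → ℕ → ℝ) (gIR : ℝ) (hθ₅ρ : θ₅ ≤ ρ) (hνρ : ν < ρ) (hρ0 : 0 < ρ) (hρ1 : ρ < 1)
    (hrun : ∀ K, RGEqH K β (g K)) (hbox : ∀ K i, i ≤ K → 0 < g K i ∧ g K i ≤ γ) (hpin : ∀ K, g K K = gIR)
    (hsmall : cr * (ℓ / ν) * ν * (ρ / (ρ - ν)) ≤ (1 - ρ) / 2) :
    InjectedRate (2 * (cr * C₅ * θ₅) / (1 - ρ)) 0 ρ (fun K j => disc (g K) (g (K + 1)) j) := by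
  subst hℓ hν hC₅
  have hK := ne9_and_fadingMemory_of_couplingTwoPoint G ρT expl h0 hAdm hres hadd hsum hstep hfac hclip0
    (couplingTwoPoint_of_gaussian G hT hn ub hIdx hact hWtfloor hε hc hγ hab ha hα0 hα hub hprem hem he₁m hVs he₁ hM₀ hM₁
      hlink hF hbd hdil hdom₀ hdom₁ hsize hmod)
    hqT0 hTcup hrepr hexpl hclipb hpexb hpexbar hqTb hKP hdec hpinB hρT hocc hB0 hlipb hτbar hω hpos hτ
  obtain ⟨hS, hL, hM⟩ := ne4T_of_gaussNE9_endNE5 G hT hn ub hIdx hact hWtfloor hε hc hγ hab ha hα0 hα hub hprem hem he₁m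
    hVs he₁ hM₀ hM₁ hlink hF hbd hdil hdom₀ hdom₁ hsize hmod ρT expl h0 hAdm hres hadd hsum hstep hfac hclip0 hqT0 hTcup
    hrepr hexpl hclipb hpexb hpexbar hqTb hKP hdec hpinB hρT hocc hB0 hlipb hτbar hω hpos hτ rfl rfl Mf hdA hunit hr₀ hc₁
    hrAf hrBf hbasef hlipf hdBf hentf hflf hinsf hdampf hΛ₅ hδ₅ hθ₁ hθ₁₅ hθ₅1 hc₅ hω₅ hnear hB₅ hfirst hsmall5 rfl hW hWt
    hA hB h𝒜A h𝒜B hr hcov hcr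
  exact T4CurrencyMatching.injectedRate_of_runs_by g gIR hρ0 hρ1 (hθ₁.trans hθ₁₅) hθ₅ρ hpos.le hνρ
    (mul_nonneg (mul_nonneg hcr (NE4ReadOutSocket.ne5Const_nonneg hΛ₅ hδ₅ hr₀ hc₁ hc₅ hB₅ hsmall5)) (hθ₁.trans hθ₁₅))
    (mul_nonneg (mul_nonneg hcr (T4BetaReadOut.fadingMemory_const_nonneg hK.2)) hpos.le) zero_le_one hrun hbox hpin hS
    hL hM (T4CurrencyMatching.currencyWeight_invSq γ) (by rw [mul_one]; exact hsmall)

end Summit.QuantumFields.BalabanUV.T4Continuum.NE4ReadOutSocketGaussian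

end
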